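import Mathlib.MeasureTheory.Integral.Lebesgue.Add
import Literature.Geometry.Riemannian.ChangGurskyYangProofs
import Literature.Geometry.Riemannian.VolumeScaling
import HarnessLib

/-!
# Scale invariance of the Weyl energy `∫_M |W|² dV` in dimension `4`
(topic `Geometry/Riemannian`)

One of the sanity lemmas asked for with the definition of the Weyl energy
`g.weylEnergy = ∫_M |W_g|² dV_g` (`WeylEnergy.lean`, definition request `defn-weylEnergy`, the
`(0,4)`-norm `|W|² = W_{ijkl}W^{ijkl}` of Chang–Gursky–Yang 2003, Remark 2): under a constant
rescaling `g ↦ c g` (`c > 0`, `PseudoRiemannianMetric.constSmul` of `RicciFlowScaling.lean`)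

* the Riemannian measure scales by `(√c)^{dim M}` — `riemVolume_constSmul`, the measure form of
  `vol_constSmul` (`VolumeScaling.lean`; Federer 1969, §2.10.11: Hausdorff measure under the
  `√c`-Lipschitz identity `(M, d_g) → (M, d_{c g})` and its inverse);
* the pointwise squared Weyl norm scales by `c⁻²` — `weylNormSq_constSmul`
  (`ChangGurskyYangProofs.lean`; the Levi-Civita connection and the `(1,3)` curvature are
  scale invariant, Topping 2006, §1.2.3, so `W_{ijkl}` on a `(c g)`-orthonormal frame is `c⁻¹` times
  `W_{ijkl}` of `g` on the rescaled, `g`-orthonormal, frame);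

hence `∫_M |W_{c g}|² dV_{c g} = (√c)^{dim M} c⁻² ∫_M |W_g|² dV_g` (`weylEnergy_constSmul`), which
in dimension `dim M = 4` is the **scale invariance of the Weyl functional**
`∫ |W_{c g}|² dV_{c g} = ∫ |W_g|² dV_g` (`weylEnergy_constSmul_of_finrank_eq_four`, and its
`𝓡 4`-model form `weylEnergy_constSmul_four` in the binder of the `SmoothPoincare4` routes) — the
constant-factor case of the conformal invariance of `∫_{M⁴} |W|² dvol` stated by
Chang–Gursky–Yang 2003, p. 105 ("our condition has the additional properties of being sharp and
conformally invariant", about (0.3) `∫_{M⁴} |W|² dvol < 16π² χ(M⁴)`).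

All statements are theorems (no named facts); the file is a leaf of the import graph (it imports
the Ricci-flow scaling files through `VolumeScaling.lean`, so it is deliberately NOT merged into
the fact-free definition file `WeylEnergy.lean`).

## References

* S.-Y. A. Chang, M. J. Gursky, P. C. Yang, *A conformally invariant sphere theorem in four
  dimensions*, Publ. Math. IHÉS 98 (2003) 105–143 (arXiv:math/0309287), p. 105, (0.3) and
  Remark 2. [ChangGurskyYang2003]
* P. Topping, *Lectures on the Ricci flow* (2006), §1.2.3 (scaling of `g`, `∇`, `Rm`, `Ric`, `R`,
  `dV`). [Topping2006]
* H. Federer, *Geometric Measure Theory* (1969), §2.10.11. [Federer1969]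
-/

noncomputable section

open Bundle Module MeasureTheory
open scoped Manifold ContDiff Topology ENNReal

namespace Literature.Geometry.Riemannian

open Literature.Geometry.Lorentzian (PseudoRiemannianMetric riemannianMeasure)
open Literature.Geometry.Lorentzian.PseudoRiemannianMetric

variable {E : Type*} [NormedAddCommGroup E] [NormedSpace ℝ E] {H : Type*} [TopologicalSpace H]
  {I : ModelWithCorners ℝ E H} {M : Type*} [TopologicalSpace M] [ChartedSpace H M]
  [IsManifold I ∞ M] {n : ℕ∞ω} [FiniteDimensional ℝ E]

/-- **`dV_{c g} = (√c)^{dim M} dV_g` as measures** (`c > 0`): the measure form of the set-wise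
identity `vol_constSmul` (both sides are the junk measure `0` if `g` is not Riemannian).
[cite: Federer1969, §2.10.11] [cite: Topping2006, §1.2.3] -/
theorem _root_.Literature.Geometry.Lorentzian.PseudoRiemannianMetric.riemVolume_constSmul
    [T3Space M] [MeasurableSpace M] [BorelSpace M]
    (g : PseudoRiemannianMetric I n E (TangentSpace I : M → Type _)) {c : ℝ} (hc : 0 < c) :
    (g.constSmul c hc.ne').riemVolume =
      (ENNReal.ofReal (Real.sqrt c) ^ finrank ℝ E) • g.riemVolume := by
  ext s _
  rw [Measure.smul_apply, smul_eq_mul]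
  exact vol_constSmul g hc s

variable {g : PseudoRiemannianMetric I n E (TangentSpace I : M → Type _)}
variable [g.HasLeviCivita] [CompleteSpace E] [Fact (1 ≤ n)]

/-- **The Weyl energy under constant rescaling**, any dimension `m = dim M`:
`∫_M |W_{c g}|² dV_{c g} = (√c)^m · c⁻² · ∫_M |W_g|² dV_g` for `c > 0` — the integrand scales by
`c⁻²` (`weylNormSq_constSmul`) and the measure by `(√c)^m` (`riemVolume_constSmul`); both sides
are `0` if `g` is not Riemannian. [cite: Topping2006, §1.2.3] [cite: ChangGurskyYang2003, (0.3)] -/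
theorem _root_.Literature.Geometry.Lorentzian.PseudoRiemannianMetric.weylEnergy_constSmul
    [T2Space M] {c : ℝ} (hc : 0 < c) [(g.constSmul c hc.ne').HasLeviCivita] :
    (g.constSmul c hc.ne').weylEnergy =
      ENNReal.ofReal (Real.sqrt c) ^ finrank ℝ E * ENNReal.ofReal (c⁻¹ ^ 2) * g.weylEnergy := by
  haveI : LocallyCompactSpace M := Manifold.locallyCompact_of_finiteDimensional I
  letI : MeasurableSpace M := borel M
  haveI : BorelSpace M := ⟨rfl⟩
  by_cases hg : g.IsRiemannian
  · have hg' : (g.constSmul c hc.ne').IsRiemannian := hg.constSmul hc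
    have h2 : ∀ x, ENNReal.ofReal (c⁻¹ ^ 2 * g.weylNormSq x) =
        ENNReal.ofReal (c⁻¹ ^ 2) * ENNReal.ofReal (g.weylNormSq x) := fun x ↦
      ENNReal.ofReal_mul (by positivity)
    rw [(g.constSmul c hc.ne').weylEnergy_eq hg', g.weylEnergy_eq hg, ← riemVolume_eq hg',
      ← riemVolume_eq hg, riemVolume_constSmul g hc, lintegral_smul_measure, smul_eq_mul]
    simp_rw [weylNormSq_constSmul hc, h2]
    rw [lintegral_const_mul' _ _ ENNReal.ofReal_ne_top, mul_assoc]
  · have hg' : ¬ (g.constSmul c hc.ne').IsRiemannian := (isRiemannian_constSmul_iff hc).not.mpr hg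
    rw [g.weylEnergy_of_not_isRiemannian hg, (g.constSmul c hc.ne').weylEnergy_of_not_isRiemannian hg',
      mul_zero]

/-- **Scale invariance of the Weyl energy in dimension `4`**: `∫_M |W_{c g}|² dV_{c g} =
∫_M |W_g|² dV_g` for `c > 0` when `dim M = 4` (`(√c)⁴ · c⁻² = 1`) — the constant-factor case of the
conformal invariance of the Weyl functional `g ↦ ∫|W|² dvol` in four dimensions
(Chang–Gursky–Yang 2003, p. 105 and (0.3)). [cite: ChangGurskyYang2003, p. 105 and (0.3)]
[cite: Topping2006, §1.2.3] -/
theorem _root_.Literature.Geometry.Lorentzian.PseudoRiemannianMetric.weylEnergy_constSmul_of_finrank_eq_four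
    [T2Space M] (hE : finrank ℝ E = 4) {c : ℝ} (hc : 0 < c) [(g.constSmul c hc.ne').HasLeviCivita] :
    (g.constSmul c hc.ne').weylEnergy = g.weylEnergy := by
  have h1 : Real.sqrt c ^ 4 * c⁻¹ ^ 2 = 1 := by
    rw [show (4 : ℕ) = 2 * 2 from rfl, pow_mul, Real.sq_sqrt hc.le, ← mul_pow,
      mul_inv_cancel₀ hc.ne', one_pow]
  rw [weylEnergy_constSmul hc, hE, ← ENNReal.ofReal_pow (Real.sqrt_nonneg c),
    ← ENNReal.ofReal_mul (by positivity), h1, ENNReal.ofReal_one, one_mul]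

omit [FiniteDimensional ℝ E] [g.HasLeviCivita] [CompleteSpace E] in
/-- **Scale invariance of the Weyl energy on a `4`-manifold modelled on `ℝ⁴`** (the binder of the
`SmoothPoincare4` routes: `ChartedSpace (EuclideanSpace ℝ (Fin 4)) M`, model `𝓡 4`):
`(c g).weylEnergy = g.weylEnergy` for `c > 0`. [cite: ChangGurskyYang2003, p. 105 and (0.3)] -/
theorem _root_.Literature.Geometry.Lorentzian.PseudoRiemannianMetric.weylEnergy_constSmul_four
    {M : Type*} [TopologicalSpace M] [T2Space M] [ChartedSpace (EuclideanSpace ℝ (Fin 4)) M]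
    [IsManifold (𝓡 4) ∞ M]
    {g : PseudoRiemannianMetric (𝓡 4) n (EuclideanSpace ℝ (Fin 4)) (TangentSpace (𝓡 4) : M → Type _)}
    [g.HasLeviCivita] {c : ℝ} (hc : 0 < c) [(g.constSmul c hc.ne').HasLeviCivita] :
    (g.constSmul c hc.ne').weylEnergy = g.weylEnergy :=
  weylEnergy_constSmul_of_finrank_eq_four (by rw [finrank_euclideanSpace, Fintype.card_fin]) hc

end Literature.Geometry.Riemannian

end
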